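import Summits.AnomalousDissipation.AnomalousDissipation.Theorems.ScalarAnomalySteadySourceFormal.Negative.DriftDissipation
import Summits.AnomalousDissipation.AnomalousDissipation.Theorems.ScalarAnomalySteadySourceFormal.Negative.KillShape

/-!
# Negative knowledge for the crux `ScalarAnomalySteadySourceFormal` (stmt-AnomalousDissipation-0448), VI-d: REFUTED STRENGTHENING — constant drifts (Galilean states) are dead

Certified copy of §8 (part 4): `∑ₖ≠0‖𝓕θ_p(k)‖² ≤ 8E` from the variance floors, the spectral tail of the source, the K-split, and `constantDrift_not_anomalous` / `not_cruxConstantDrift`: NO witness of the crux has constant drifts `v_j ≡ c_j`, for any `L²` data and any weak solutions of the crux's class.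
Supports stmt-AnomalousDissipation-0448.
-/

set_option linter.dupNamespace false

noncomputable section

open scoped BigOperators Topology ENNReal NNReal InnerProductSpace ContDiff
open MeasureTheory Set Filter Function UnitAddTorus Complex

namespace Summit.AnomalousDissipation.AnomalousDissipation.Theorems.ScalarAnomalySteadySourceFormal.Negative

open Literature.Analysis
open Literature.Analysis.FunctionSpaces Literature.Analysis.FunctionSpaces.Torus
open Literature.Analysis.FluidPDE Literature.Analysis.FluidPDE.Torus

variable {d : Type*} [Fintype d] [DecidableEq d]
open Summit.AnomalousDissipation.AnomalousDissipation.Theses.TwoAndHalfD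

section DriftNoGo

variable {ν : ℝ} {c : EuclideanSpace ℝ d} {h θ₀ : UnitAddTorus d → ℝ} {θ : ℝ → UnitAddTorus d → ℝ}

/-- From the multi-mode variance floors: the steady coefficients (off the zero mode) are
square-summable with `∑ₖ≠0 ‖𝓕θ_p(k)‖² ≤ 8E`. [folklore] -/
theorem tsum_sq_coeff_le (hν : 0 < ν) (hh : IsSmooth h) (hmean : HasZeroMean h) (hθ₀ : MemLp θ₀ 2 volume)
    (hweak : IsWeakScalarTransportForced ν (fun (_ : ℝ) (_ : UnitAddTorus d) => c) (fun _ => h) θ₀ θ)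
    {E : ℝ} (hE : longTimeAvgSup (fun t => scalarL2Sq (θ t)) ≤ E) :
    Summable (fun k : d → ℤ => if k = 0 then 0 else ‖mFourierCoeff (fun x => (driftState ν c h x : ℂ)) k‖ ^ 2) ∧
      ∑' k : d → ℤ, (if k = 0 then 0 else ‖mFourierCoeff (fun x => (driftState ν c h x : ℂ)) k‖ ^ 2) ≤ 8 * E := by
  set X : (d → ℤ) → ℝ := fun k => if k = 0 then 0 else ‖mFourierCoeff (fun x => (driftState ν c h x : ℂ)) k‖ ^ 2 with hX
  have hX0 : ∀ k, 0 ≤ X k := fun k => by simp only [hX]; split_ifs <;> positivity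
  have hF : ∀ F : Finset (d → ℤ), ∑ k ∈ F, X k ≤ 8 * E := by
    intro F
    classical
    have hsum : ∑ k ∈ F, X k = ∑ k ∈ F.filter (· ≠ 0), ‖mFourierCoeff (fun x => (driftState ν c h x : ℂ)) k‖ ^ 2 := by
      rw [Finset.sum_filter]
      refine Finset.sum_congr rfl fun k _ => ?_
      simp only [hX]
      split_ifs with hk <;> simp_all
    rw [hsum]
    have hfl := d_variance_floor hν hh hmean hθ₀ hweak (F.filter (· ≠ 0)) (fun k hk => (Finset.mem_filter.1 hk).2)
    linarith [hfl.trans hE]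
  have hs : Summable X := summable_of_sum_le hX0 hF
  exact ⟨hs, hs.tsum_le_of_sum_le hF⟩

/-- The spectral TAIL of the source: `tail Λ = ∑_{|k|² > Λ} ‖𝓕h(k)‖²`. [folklore] -/
def sourceTail (h : UnitAddTorus d → ℝ) (Λ : ℝ) : ℝ :=
  ∑' k : d → ℤ, if Λ < freqNormSq k then ‖mFourierCoeff (fun x => (h x : ℂ)) k‖ ^ 2 else 0

omit [DecidableEq d] in
/-- Helper `sourceTail_nonneg` (see the file docstring). [folklore] -/
theorem sourceTail_nonneg (h : UnitAddTorus d → ℝ) (Λ : ℝ) : 0 ≤ sourceTail h Λ :=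
  tsum_nonneg fun k => by split_ifs <;> positivity

omit [DecidableEq d] in
/-- Helper `summable_sourceTail_term` (see the file docstring). [folklore] -/
theorem summable_sourceTail_term {h : UnitAddTorus d → ℝ} (hh : IsSmooth h) (Λ : ℝ) :
    Summable fun k : d → ℤ => if Λ < freqNormSq k then ‖mFourierCoeff (fun x => (h x : ℂ)) k‖ ^ 2 else 0 := by
  have hpar := FunctionSpaces.Torus.hasSum_sq_norm_mFourierCoeff_ofReal (hh.memLp 2)
  refine Summable.of_nonneg_of_le (fun k => by split_ifs <;> positivity) (fun k => ?_) hpar.summable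
  split_ifs <;> simp

omit [DecidableEq d] in
/-- **The tail vanishes**: `tail Λ → 0` as `Λ → ∞` (`h ∈ L²`). [folklore] -/
theorem sourceTail_small {h : UnitAddTorus d → ℝ} (hh : IsSmooth h) {η : ℝ} (hη : 0 < η) :
    ∃ Λ₀ : ℝ, 0 < Λ₀ ∧ ∀ Λ, Λ₀ ≤ Λ → sourceTail h Λ ≤ η := by
  classical
  have hpar := FunctionSpaces.Torus.hasSum_sq_norm_mFourierCoeff_ofReal (hh.memLp 2)
  set N2 : (d → ℤ) → ℝ := fun k => ‖mFourierCoeff (fun x => (h x : ℂ)) k‖ ^ 2 with hN2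
  have htend := tendsto_tsum_compl_atTop_zero N2
  obtain ⟨S, hS⟩ := (eventually_atTop.1 (htend.eventually (Iio_mem_nhds hη)))
  have hS' : ∑' k : {x // x ∉ S}, N2 k < η := hS S le_rfl
  refine ⟨∑ k ∈ S, freqNormSq k + 1, by have := Finset.sum_nonneg (fun k (_ : k ∈ S) => freqNormSq_nonneg k); linarith,
    fun Λ hΛ => ?_⟩
  have hmem : ∀ k, Λ < freqNormSq k → k ∉ S := by
    intro k hk hkS
    have : freqNormSq k ≤ ∑ k ∈ S, freqNormSq k := Finset.single_le_sum (fun k _ => freqNormSq_nonneg k) hkS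
    linarith
  have hle : sourceTail h Λ ≤ ∑' k, ((↑S : Set (d → ℤ))ᶜ).indicator N2 k := by
    unfold sourceTail
    refine Summable.tsum_le_tsum (fun k => ?_) (summable_sourceTail_term hh Λ) (hpar.summable.indicator _)
    split_ifs with hk
    · rw [Set.indicator_of_mem (by simpa using hmem k hk)]
    · exact Set.indicator_nonneg (fun _ _ => by positivity) _
  rw [← tsum_subtype] at hle
  exact hle.trans hS'.le

end DriftNoGo

section DriftAssembly

variable {ν : ℝ} {c : EuclideanSpace ℝ d} {h θ₀ : UnitAddTorus d → ℝ} {θ : ℝ → UnitAddTorus d → ℝ}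

/-- **K-SPLIT** of the dissipation sum at the threshold `Λ`:
`∑ₖ |k|² ‖𝓕θ_p(k)‖² ≤ Λ ∑ₖ≠0 ‖𝓕θ_p(k)‖² + tail(Λ)/((4π²ν)²Λ)`. [folklore] -/
theorem dissipationSum_le_split (hν : 0 < ν) (c : EuclideanSpace ℝ d) (hh : IsSmooth h) (hmean : HasZeroMean h)
    {Λ : ℝ} (hΛ : 0 < Λ)
    (hX : Summable fun k : d → ℤ => if k = 0 then 0 else ‖mFourierCoeff (fun x => (driftState ν c h x : ℂ)) k‖ ^ 2) :
    ∑' k, freqNormSq k * ‖mFourierCoeff (fun x => (driftState ν c h x : ℂ)) k‖ ^ 2 ≤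
      Λ * ∑' k : d → ℤ, (if k = 0 then 0 else ‖mFourierCoeff (fun x => (driftState ν c h x : ℂ)) k‖ ^ 2) +
        sourceTail h Λ / ((4 * Real.pi ^ 2 * ν) ^ 2 * Λ) := by
  set P : (d → ℤ) → ℂ := fun k => mFourierCoeff (fun x => (driftState ν c h x : ℂ)) k with hP
  set N2 : (d → ℤ) → ℝ := fun k => ‖mFourierCoeff (fun x => (h x : ℂ)) k‖ ^ 2 with hN2
  have hC : 0 < (4 * Real.pi ^ 2 * ν) ^ 2 * Λ := by positivity
  have hterm : ∀ k, freqNormSq k * ‖P k‖ ^ 2 ≤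
      Λ * (if k = 0 then 0 else ‖P k‖ ^ 2) + (if Λ < freqNormSq k then N2 k else 0) / ((4 * Real.pi ^ 2 * ν) ^ 2 * Λ) := by
    intro k
    by_cases hk : k = 0
    · subst hk
      simp [FunctionSpaces.Torus.freqNormSq]
      positivity
    rw [if_neg hk]
    by_cases hlt : Λ < freqNormSq k
    · rw [if_pos hlt]
      have hfk : 0 < freqNormSq k := hΛ.trans hlt
      have hq : ‖P k‖ ≤ ‖mFourierCoeff (fun x => (h x : ℂ)) k‖ / (4 * Real.pi ^ 2 * ν * freqNormSq k) := by
        simp only [hP]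
        rw [mFourierCoeff_driftState hν c hh hmean hk]
        exact norm_driftCoeff_le hν c h hk
      have hq0 : 0 ≤ ‖P k‖ := norm_nonneg _
      have hNk : 0 ≤ ‖mFourierCoeff (fun x => (h x : ℂ)) k‖ := norm_nonneg _
      have h1 : freqNormSq k * ‖P k‖ ^ 2 ≤ N2 k / ((4 * Real.pi ^ 2 * ν) ^ 2 * freqNormSq k) := by
        calc freqNormSq k * ‖P k‖ ^ 2
            ≤ freqNormSq k * (‖mFourierCoeff (fun x => (h x : ℂ)) k‖ / (4 * Real.pi ^ 2 * ν * freqNormSq k)) ^ 2 := by gcongr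
          _ = N2 k / ((4 * Real.pi ^ 2 * ν) ^ 2 * freqNormSq k) := by simp only [hN2]; field_simp
      have h2 : N2 k / ((4 * Real.pi ^ 2 * ν) ^ 2 * freqNormSq k) ≤ N2 k / ((4 * Real.pi ^ 2 * ν) ^ 2 * Λ) := by
        apply div_le_div_of_nonneg_left (by positivity) hC
        gcongr
      have h3 : 0 ≤ Λ * ‖P k‖ ^ 2 := by positivity
      linarith
    · rw [if_neg hlt]
      have hle : freqNormSq k ≤ Λ := not_lt.1 hlt
      have : freqNormSq k * ‖P k‖ ^ 2 ≤ Λ * ‖P k‖ ^ 2 := mul_le_mul_of_nonneg_right hle (sq_nonneg _)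
      simpa using this
  have hs1 := summable_freqNormSq_mul_sq hν c hh hmean
  have hs2 : Summable fun k : d → ℤ => Λ * (if k = 0 then 0 else ‖P k‖ ^ 2) +
      (if Λ < freqNormSq k then N2 k else 0) / ((4 * Real.pi ^ 2 * ν) ^ 2 * Λ) :=
    (hX.mul_left Λ).add ((summable_sourceTail_term hh Λ).div_const _)
  calc ∑' k, freqNormSq k * ‖P k‖ ^ 2
      ≤ ∑' k, (Λ * (if k = 0 then 0 else ‖P k‖ ^ 2) +
        (if Λ < freqNormSq k then N2 k else 0) / ((4 * Real.pi ^ 2 * ν) ^ 2 * Λ)) := Summable.tsum_le_tsum hterm hs1 hs2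
    _ = Λ * ∑' k : d → ℤ, (if k = 0 then 0 else ‖P k‖ ^ 2) + sourceTail h Λ / ((4 * Real.pi ^ 2 * ν) ^ 2 * Λ) := by
        rw [(hX.mul_left Λ).tsum_add ((summable_sourceTail_term hh Λ).div_const _), tsum_mul_left, tsum_div_const]
        rfl

/-- **CONSTANT-DRIFT NO-GO (refuted strengthening of the crux).** No family of weak solutions of the
sourced advection–diffusion equation with CONSTANT drifts `v_j ≡ c_j` (Galilean states), `ν_j → 0`,
`L²` data, one smooth mean-zero source and `j`-uniformly bounded mean variance can have a `j`-uniform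
positive floor under its mean dissipation: the variance bound caps `∑ₖ≠0 ‖𝓕θ_{p,j}(k)‖² ≤ 8E`, the
dissipation ceiling and the K-split at `Λ = μ/ν_j` give `⟨ν_j‖∇θ_j‖²⟩ ≤ 64π²μE + tail(μ/ν_j)/(2π²μ)`,
small for `μ` small and then `j` large. [folklore] -/
theorem constantDrift_not_anomalous (hh : IsSmooth h) (hmean : HasZeroMean h) {νs : ℕ → ℝ}
    (hν : ∀ j, 0 < νs j) (hν0 : Tendsto νs atTop (nhds 0)) {cs : ℕ → EuclideanSpace ℝ d}
    {θ₀s : ℕ → UnitAddTorus d → ℝ} (hθ₀ : ∀ j, MemLp (θ₀s j) 2 volume) {θs : ℕ → ℝ → UnitAddTorus d → ℝ}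
    (hweak : ∀ j, IsWeakScalarTransportForced (νs j) (fun (_ : ℝ) (_ : UnitAddTorus d) => cs j)
      (fun _ => h) (θ₀s j) (θs j))
    {E : ℝ} (hV : ∀ j, longTimeAvgSup (fun t => scalarL2Sq (θs j t)) ≤ E) :
    ¬ ∃ ε : ℝ, 0 < ε ∧ ∀ j, ε ≤ longTimeAvgSup (fun t => νs j * (eScalarGradNormSq (θs j t)).toReal) := by
  rintro ⟨ε, hε, hfl⟩
  have hE0 : 0 ≤ E := (longTimeAvgSup_nonneg fun t => scalarL2Sq_nonneg (θs 0 t)).trans (hV 0)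
  set μ : ℝ := ε / (4 * (64 * Real.pi ^ 2 * E + 1)) with hμ
  have hμ0 : 0 < μ := by rw [hμ]; positivity
  have h64 : 64 * Real.pi ^ 2 * μ * E ≤ ε / 4 := by
    rw [hμ]
    rw [show 64 * Real.pi ^ 2 * (ε / (4 * (64 * Real.pi ^ 2 * E + 1))) * E =
      ε / 4 * (64 * Real.pi ^ 2 * E / (64 * Real.pi ^ 2 * E + 1)) by field_simp]
    have : 64 * Real.pi ^ 2 * E / (64 * Real.pi ^ 2 * E + 1) ≤ 1 := by
      rw [div_le_one (by positivity)]; linarith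
    nlinarith
  obtain ⟨Λ₀, hΛ₀, htail⟩ := sourceTail_small hh (η := ε / 4 * (2 * Real.pi ^ 2 * μ)) (by positivity)
  -- choose `j` with `ν_j < μ / Λ₀`
  obtain ⟨j, hj⟩ := ((tendsto_order.1 hν0).2 (μ / Λ₀) (by positivity)).exists
  set ν := νs j with hνdef
  have hνpos : 0 < ν := hν j
  set Λ : ℝ := μ / ν with hΛdef
  have hΛpos : 0 < Λ := by rw [hΛdef]; positivity
  have hΛ0 : Λ₀ ≤ Λ := by
    rw [hΛdef, le_div_iff₀ hνpos]
    have := hj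
    rw [lt_div_iff₀ hΛ₀] at this
    linarith
  have hνΛ : ν * Λ = μ := by rw [hΛdef]; field_simp
  obtain ⟨hXs, hXle⟩ := tsum_sq_coeff_le (hν j) hh hmean (hθ₀ j) (hweak j) (hV j)
  have hceil := d_dissipation_limsup_le (hν j) hh hmean (hθ₀ j) (hweak j) (summable_freqNormSq_mul_sq (hν j) (cs j) hh hmean)
  have hsplit := dissipationSum_le_split (hν j) (cs j) hh hmean hΛpos hXs
  have htl := htail Λ hΛ0
  have htl0 := sourceTail_nonneg h Λ
  -- the arithmetic
  have step : 8 * Real.pi ^ 2 * ν * (Λ * (8 * E) + sourceTail h Λ / ((4 * Real.pi ^ 2 * ν) ^ 2 * Λ)) =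
      64 * Real.pi ^ 2 * μ * E + sourceTail h Λ / (2 * Real.pi ^ 2 * μ) := by
    rw [← hνΛ]; field_simp; ring
  have hbound : longTimeAvgSup (fun t => νs j * (eScalarGradNormSq (θs j t)).toReal) ≤ ε / 2 := by
    calc longTimeAvgSup (fun t => νs j * (eScalarGradNormSq (θs j t)).toReal)
        ≤ 8 * Real.pi ^ 2 * ν * ∑' k, freqNormSq k * ‖mFourierCoeff (fun x => (driftState ν (cs j) h x : ℂ)) k‖ ^ 2 := hceil
      _ ≤ 8 * Real.pi ^ 2 * ν * (Λ * (8 * E) + sourceTail h Λ / ((4 * Real.pi ^ 2 * ν) ^ 2 * Λ)) := by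
          refine mul_le_mul_of_nonneg_left (hsplit.trans ?_) (by positivity)
          gcongr
      _ = 64 * Real.pi ^ 2 * μ * E + sourceTail h Λ / (2 * Real.pi ^ 2 * μ) := step
      _ ≤ ε / 4 + (ε / 4 * (2 * Real.pi ^ 2 * μ)) / (2 * Real.pi ^ 2 * μ) := by
          gcongr
      _ = ε / 2 := by field_simp; ring
  linarith [hfl j]

end DriftAssembly

/-- **REFUTED STRENGTHENING: no witness of the crux has a constant (Galilean) flow `v_j ≡ c_j`.**
[folklore] -/
theorem not_cruxConstantDrift :
    ¬ ∃ (g : UnitAddTorus (Fin 2) → EuclideanSpace ℝ (Fin 2)) (h : UnitAddTorus (Fin 2) → ℝ), IsAdmissible g h ∧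
      ∃ (ν : ℕ → ℝ) (cs : ℕ → EuclideanSpace ℝ (Fin 2)) (θ₀ : ℕ → UnitAddTorus (Fin 2) → ℝ)
        (θ : ℕ → ℝ → UnitAddTorus (Fin 2) → ℝ), (∀ j, 0 < ν j) ∧
        Tendsto ν atTop (nhds 0) ∧ (∀ j, MemLp (θ₀ j) 2 volume) ∧
        (∀ j, IsWeakScalarTransportForced (ν j) (fun (_ : ℝ) (_ : UnitAddTorus (Fin 2)) => cs j) (fun _ => h) (θ₀ j) (θ j)) ∧
        VarianceBounded θ ∧ Anomalous ν θ := by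
  rintro ⟨g, h, hadm, ν, cs, θ₀, θ, hν, hν0, hθ₀, hweak, ⟨E, hE⟩, hA⟩
  exact constantDrift_not_anomalous hadm.smooth_h hadm.zeroMean_h hν hν0 hθ₀ hweak hE hA

/-- The same through the clause bundle: a candidate family with constant drifts and bounded
variance is never anomalous. [folklore] -/
theorem not_anomalous_of_isCandidate_constantDrift {g : UnitAddTorus (Fin 2) → EuclideanSpace ℝ (Fin 2)}
    {h : UnitAddTorus (Fin 2) → ℝ} (hadm : IsAdmissible g h)
    {ν : ℕ → ℝ} {v₀ : ℕ → UnitAddTorus (Fin 2) → EuclideanSpace ℝ (Fin 2)} {cs : ℕ → EuclideanSpace ℝ (Fin 2)}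
    {θ₀ : ℕ → UnitAddTorus (Fin 2) → ℝ} {θ : ℕ → ℝ → UnitAddTorus (Fin 2) → ℝ}
    (hc : IsCandidate g h ν v₀ (fun j _ _ => cs j) θ₀ θ) (hV : VarianceBounded θ) : ¬ Anomalous ν θ := by
  obtain ⟨E, hE⟩ := hV
  exact constantDrift_not_anomalous hadm.smooth_h hadm.zeroMean_h hc.pos hc.tendsto hc.memLp hc.weak hE

end Summit.AnomalousDissipation.AnomalousDissipation.Theorems.ScalarAnomalySteadySourceFormal.Negative
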